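import Mathlib
import Summits.NavierStokesRegularity.NavierStokesRegularity.Theorems.FilamentSkeletonRssKelvinGateTools

/-!
# Route `FilamentSkeletonRss` · crux `TransverseReductionRJ` (stmt-NavierStokesRegularity-21221) — line `kelvin_gate`, stub S3
# `NonlinearClosingFrom`: tools for the «spike functional» witness (part 1 of 3: one-dimensional tools)

Helper file (theorems only, `--supports stmt-NavierStokesRegularity-21221`), vocabulary of `FilamentSkeletonRssKelvinGateDefs`
(`YBound`).  HONEST FRAMING: bookkeeping for a HYPOTHETICAL filament-type RSS blow-up route (MODEL rung, negative side, ASIDE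
item); nothing here bears on Navier–Stokes regularity; the registered stub `stub_nonlinearClosing : NonlinearClosingFrom` is
neither proved nor refuted by this series.

PURPOSE OF THE SERIES (`…TightnessSpikeTools` → `…TightnessSpikeData` → `…TightnessNonUniform`).  `nonlinearClosing_static` (landed)
reduces S3 to the continuity on the cube of the multipliers `p ↦ b⁰_p + 𝓑_p G_p` at the Picard fixed-point forcing, and
`GateSpec.continuousOn_multiplier_of_uniformTight` (p826991) proves it once clause (3) of `GateSpec` (tightness) is quantified
UNIFORMLY in `p`.  The series shows the uniformity cannot be dropped at the level of the clauses `GateSpec` imposes on the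
multiplier functional `𝓑`: an explicit family satisfying the `𝓑`-parts of clauses (1)–(4) AS TYPED (tightness PER `p`) and an
explicit uniformly `Y`-bounded, uniformly-in-space continuous data family `G_p` with `p ↦ 𝓑_p G_p` discontinuous
(`perParameter_tightness_insufficient`, part 3).  THIS FILE: the spike functional `F ↦ ∫ φ(t) sin(kt) ∂_t⟪F(te),e⟫ dt` along a
line — Riemann–Lebesgue in `ε`–`N` form (continuity at frequency `∞`), integration by parts against the smooth compactly supported
weight (tightness at ONE frequency, constant `~k`), the uniform bound `R·∫φ`, and the frequency-Lipschitz bound.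
-/

set_option linter.dupNamespace false

noncomputable section

namespace Summit.NavierStokesRegularity.NavierStokesRegularity.Theorems.KelvinGate

open Set Function Filter MeasureTheory Topology Real
open scoped InnerProductSpace FourierTransform

/-! ## §1  One-dimensional tools: Riemann–Lebesgue for `sin`, integration by parts against a compactly supported weight -/

/-- Riemann–Lebesgue for the sine transform of a real continuous compactly supported function, in `ε`–`N` form:
`∫ h(t) sin(2π t w) dt → 0` as `w → +∞`. [folklore; Mathlib `Real.tendsto_integral_exp_smul_cocompact`] -/
theorem sin_transform_small_of_continuous_compactSupport {h : ℝ → ℝ} (hc : Continuous h) (hs : HasCompactSupport h)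
    {ε : ℝ} (hε : 0 < ε) : ∃ N : ℝ, 0 < N ∧ ∀ w : ℝ, N ≤ w → |∫ t, h t * Real.sin (2 * π * w * t)| ≤ ε := by
  have hint : Integrable h := hc.integrable_of_hasCompactSupport hs
  have hT := Real.tendsto_integral_exp_smul_cocompact (fun t => (h t : ℂ))
  rw [cocompact_eq_atBot_atTop] at hT
  have hT' := hT.mono_left le_sup_right
  rw [NormedAddGroup.tendsto_nhds_zero] at hT'
  obtain ⟨N, hN⟩ := Filter.eventually_atTop.mp (hT' ε hε)
  refine ⟨max N 1, lt_of_lt_of_le one_pos (le_max_right _ _), fun w hw => ?_⟩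
  have hwN : N ≤ w := le_trans (le_max_left _ _) hw
  have key := hN w hwN
  -- the imaginary part of the Fourier-type integral is `-∫ h(t) sin(2π t w)`
  have hintC : Integrable (fun v : ℝ => 𝐞 (-(v * w)) • ((h v : ℝ) : ℂ)) := by
    have := (Real.fourierIntegral_convergent_iff' (μ := volume) (f := fun v => ((h v : ℝ) : ℂ))
      (ContinuousLinearMap.mul ℝ ℝ) w).2 hint.ofReal
    simpa only [ContinuousLinearMap.mul_apply'] using this
  have him : ∀ v : ℝ, (𝐞 (-(v * w)) • ((h v : ℝ) : ℂ)).im = -(h v * Real.sin (2 * π * v * w)) := by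
    intro v
    rw [Circle.smul_def, Real.fourierChar_apply, smul_eq_mul, Complex.im_mul_ofReal,
      Complex.exp_ofReal_mul_I_im]
    have : 2 * π * -(v * w) = -(2 * π * v * w) := by ring
    rw [this, Real.sin_neg]; ring
  have hI : (∫ v : ℝ, 𝐞 (-(v * w)) • ((h v : ℝ) : ℂ)).im = -∫ t, h t * Real.sin (2 * π * t * w) := by
    have h1 := Complex.imCLM.integral_comp_comm hintC
    simp only [Complex.imCLM_apply] at h1
    rw [← h1]
    simp_rw [him]
    rw [integral_neg]
  have hle : |(∫ v : ℝ, 𝐞 (-(v * w)) • ((h v : ℝ) : ℂ)).im| ≤ ‖∫ v : ℝ, 𝐞 (-(v * w)) • ((h v : ℝ) : ℂ)‖ :=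
    Complex.abs_im_le_norm _
  rw [hI, abs_neg] at hle
  have hsw : (fun t => h t * Real.sin (2 * π * w * t)) = fun t => h t * Real.sin (2 * π * t * w) := by
    funext t; rw [show 2 * π * w * t = 2 * π * t * w by ring]
  rw [hsw]
  exact le_trans hle (le_of_lt key)


/-- Integration by parts of the spike weight `φ(t) sin(kt)` against the line restriction `t ↦ ⟪F(t e), e⟫` of a `C¹` field:
the derivative moves onto the (smooth, compactly supported) weight. [folklore] -/
theorem spike_integral_parts (φ : ContDiffBump (0:ℝ)) (k : ℝ) {F : EuclideanSpace ℝ (Fin 3) → EuclideanSpace ℝ (Fin 3)}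
    (hF : ContDiff ℝ 1 F) (e : EuclideanSpace ℝ (Fin 3)) :
    ∫ t, φ t * Real.sin (k * t) * ⟪fderiv ℝ F (t • e) e, e⟫_ℝ =
      -∫ t, (deriv φ t * Real.sin (k * t) + φ t * (Real.cos (k * t) * (k * 1))) * ⟪F (t • e), e⟫_ℝ := by
  have hFd : Differentiable ℝ F := hF.differentiable one_ne_zero
  have hφd : Differentiable ℝ (φ : ℝ → ℝ) := (φ.contDiff (n := 1)).differentiable one_ne_zero
  -- derivatives
  have hu : ∀ x : ℝ, HasDerivAt (fun t : ℝ => φ t * Real.sin (k * t))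
      (deriv φ x * Real.sin (k * x) + φ x * (Real.cos (k * x) * (k * 1))) x := fun x =>
    (hφd x).hasDerivAt.mul (((hasDerivAt_id x).const_mul k).sin)
  have hv : ∀ x : ℝ, HasDerivAt (fun t : ℝ => ⟪F (t • e), e⟫_ℝ) ⟪fderiv ℝ F (x • e) e, e⟫_ℝ x := by
    intro x
    have h1 : HasDerivAt (fun s : ℝ => s • e) ((1:ℝ) • e) x := (hasDerivAt_id x).smul_const e
    have h2 : HasDerivAt (fun s : ℝ => F (s • e)) (fderiv ℝ F (x • e) ((1:ℝ) • e)) x :=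
      (hFd (x • e)).hasFDerivAt.comp_hasDerivAt x h1
    rw [one_smul] at h2
    simpa using h2.inner ℝ (hasDerivAt_const x e)
  -- continuity and compact support
  have hcu : Continuous (fun t => φ t * Real.sin (k * t)) :=
    φ.continuous.mul (Real.continuous_sin.comp (continuous_const.mul continuous_id))
  have hcu' : Continuous (fun x => deriv φ x * Real.sin (k * x) + φ x * (Real.cos (k * x) * (k * 1))) :=
    (((φ.contDiff (n := 1)).continuous_deriv le_rfl).mul (Real.continuous_sin.comp (continuous_const.mul continuous_id))).add
      (φ.continuous.mul ((Real.continuous_cos.comp (continuous_const.mul continuous_id)).mul continuous_const))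
  have hcv : Continuous (fun t : ℝ => ⟪F (t • e), e⟫_ℝ) := by
    have h1 : Continuous (fun t : ℝ => F (t • e)) := hF.continuous.comp (continuous_id.smul continuous_const)
    exact h1.inner continuous_const
  have hcv' : Continuous (fun t : ℝ => ⟪fderiv ℝ F (t • e) e, e⟫_ℝ) := by
    have h1 : Continuous (fun t : ℝ => fderiv ℝ F (t • e)) :=
      (hF.continuous_fderiv one_ne_zero).comp (continuous_id.smul continuous_const)
    exact (h1.clm_apply continuous_const).inner continuous_const
  have hsu : HasCompactSupport (fun t => φ t * Real.sin (k * t)) := φ.hasCompactSupport.mul_right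
  have hsu' : HasCompactSupport (fun x => deriv φ x * Real.sin (k * x) + φ x * (Real.cos (k * x) * (k * 1))) :=
    (φ.hasCompactSupport.deriv.mul_right).add φ.hasCompactSupport.mul_right
  have := integral_mul_deriv_eq_deriv_mul_of_integrable (u := fun t => φ t * Real.sin (k * t))
    (u' := fun x => deriv φ x * Real.sin (k * x) + φ x * (Real.cos (k * x) * (k * 1)))
    (v := fun t => ⟪F (t • e), e⟫_ℝ) (v' := fun t => ⟪fderiv ℝ F (t • e) e, e⟫_ℝ)
    (fun x _ => hu x) (fun x _ => hv x)
    ((hcu.mul hcv').integrable_of_hasCompactSupport hsu.mul_right)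
    ((hcu'.mul hcv).integrable_of_hasCompactSupport hsu'.mul_right)
    ((hcu.mul hcv).integrable_of_hasCompactSupport hsu.mul_right)
  simpa using this

/-- TIGHTNESS AT ONE FREQUENCY: if the field is `≤ δ₀` on the ball of radius `φ.rOut`, the spike functional is
`≤ δ₀ · ∫|∂_t(φ sin(k·))|` — a constant that degenerates like `k` as the frequency grows. [folklore] -/
theorem spike_tight (φ : ContDiffBump (0:ℝ)) (k : ℝ) {F : EuclideanSpace ℝ (Fin 3) → EuclideanSpace ℝ (Fin 3)}
    (hF : ContDiff ℝ 1 F) {e : EuclideanSpace ℝ (Fin 3)} (he : ‖e‖ = 1) {δ₀ : ℝ}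
    (hδ : ∀ y : EuclideanSpace ℝ (Fin 3), ‖y‖ ≤ φ.rOut → ‖F y‖ ≤ δ₀) :
    |∫ t, φ t * Real.sin (k * t) * ⟪fderiv ℝ F (t • e) e, e⟫_ℝ| ≤
      δ₀ * ∫ t, |deriv φ t * Real.sin (k * t) + φ t * (Real.cos (k * t) * (k * 1))| := by
  rw [spike_integral_parts φ k hF e, abs_neg]
  have hcu' : Continuous (fun x => deriv φ x * Real.sin (k * x) + φ x * (Real.cos (k * x) * (k * 1))) :=
    (((φ.contDiff (n := 1)).continuous_deriv le_rfl).mul (Real.continuous_sin.comp (continuous_const.mul continuous_id))).add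
      (φ.continuous.mul ((Real.continuous_cos.comp (continuous_const.mul continuous_id)).mul continuous_const))
  have hsu' : HasCompactSupport (fun x => deriv φ x * Real.sin (k * x) + φ x * (Real.cos (k * x) * (k * 1))) :=
    (φ.hasCompactSupport.deriv.mul_right).add φ.hasCompactSupport.mul_right
  have hint : Integrable (fun t => δ₀ * |deriv φ t * Real.sin (k * t) + φ t * (Real.cos (k * t) * (k * 1))|) :=
    ((continuous_const.mul hcu'.abs).integrable_of_hasCompactSupport (hsu'.abs.mul_left))
  rw [← integral_const_mul]
  refine le_trans (Real.norm_eq_abs _ ▸ norm_integral_le_of_norm_le hint (Eventually.of_forall fun t => ?_)) le_rfl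
  rw [Real.norm_eq_abs, abs_mul]
  by_cases ht : |t| ≤ φ.rOut
  · have hv : |⟪F (t • e), e⟫_ℝ| ≤ δ₀ := by
      refine le_trans (abs_real_inner_le_norm _ _) ?_
      rw [he, mul_one]
      exact hδ _ (by rw [norm_smul, he, mul_one, Real.norm_eq_abs]; exact ht)
    calc |deriv φ t * Real.sin (k * t) + φ t * (Real.cos (k * t) * (k * 1))| * |⟪F (t • e), e⟫_ℝ|
        ≤ |deriv φ t * Real.sin (k * t) + φ t * (Real.cos (k * t) * (k * 1))| * δ₀ :=
          mul_le_mul_of_nonneg_left hv (abs_nonneg _)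
      _ = δ₀ * |deriv φ t * Real.sin (k * t) + φ t * (Real.cos (k * t) * (k * 1))| := mul_comm _ _
  · have ht' : φ.rOut < |t| := lt_of_not_ge ht
    have hdist : φ.rOut ≤ dist t 0 := by rw [Real.dist_eq, sub_zero]; exact le_of_lt ht'
    have h0 : φ t = 0 := φ.zero_of_le_dist hdist
    have h1 : deriv φ t = 0 := by
      have hnot : t ∉ tsupport (φ : ℝ → ℝ) := by
        rw [φ.tsupport_eq, Metric.mem_closedBall, Real.dist_eq, sub_zero]
        exact not_le.mpr ht'
      by_contra hne
      exact hnot (support_deriv_subset (Function.mem_support.mpr hne))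
    rw [h0, h1]; simp

/-- UNIFORM BOUND: `|∫ φ sin(k t) ∂_t⟪F(te),e⟫| ≤ R · ∫ φ` for `YBound F R`. [folklore] -/
theorem spike_bound (φ : ContDiffBump (0:ℝ)) (k : ℝ) {F : EuclideanSpace ℝ (Fin 3) → EuclideanSpace ℝ (Fin 3)} {R : ℝ}
    (hF : YBound F R) {e : EuclideanSpace ℝ (Fin 3)} (he : ‖e‖ = 1) :
    |∫ t, φ t * Real.sin (k * t) * ⟪fderiv ℝ F (t • e) e, e⟫_ℝ| ≤ R * ∫ t, φ t := by
  have hint : Integrable (fun t => R * φ t) := φ.integrable.const_mul R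
  rw [← integral_const_mul]
  refine le_trans (Real.norm_eq_abs _ ▸ norm_integral_le_of_norm_le hint (Eventually.of_forall fun t => ?_)) le_rfl
  have hD : |⟪fderiv ℝ F (t • e) e, e⟫_ℝ| ≤ R := by
    refine le_trans (abs_real_inner_le_norm _ _) ?_
    rw [he, mul_one]
    refine le_trans (ContinuousLinearMap.le_opNorm _ _) ?_
    rw [he, mul_one]
    have h2 := (hF.2 (t • e)).2
    have h1 : (1:ℝ) ≤ (1 + ‖t • e‖) ^ 2 := by nlinarith [norm_nonneg (t • e)]
    nlinarith [norm_nonneg (fderiv ℝ F (t • e))]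
  rw [Real.norm_eq_abs, abs_mul, abs_mul, abs_of_nonneg φ.nonneg]
  calc φ t * |Real.sin (k * t)| * |⟪fderiv ℝ F (t • e) e, e⟫_ℝ| ≤ φ t * 1 * R :=
        mul_le_mul (mul_le_mul_of_nonneg_left (Real.abs_sin_le_one _) φ.nonneg) hD (abs_nonneg _)
          (mul_nonneg φ.nonneg zero_le_one)
    _ = R * φ t := by ring

/-- FREQUENCY-LIPSCHITZ BOUND (continuity in the parameter away from `p₀ = 0`). [folklore] -/
theorem spike_freq_lipschitz (φ : ContDiffBump (0:ℝ)) (k k' : ℝ) {F : EuclideanSpace ℝ (Fin 3) → EuclideanSpace ℝ (Fin 3)}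
    {R : ℝ} (hF : YBound F R) {e : EuclideanSpace ℝ (Fin 3)} (he : ‖e‖ = 1) :
    |(∫ t, φ t * Real.sin (k * t) * ⟪fderiv ℝ F (t • e) e, e⟫_ℝ) - ∫ t, φ t * Real.sin (k' * t) * ⟪fderiv ℝ F (t • e) e, e⟫_ℝ|
      ≤ |k - k'| * φ.rOut * R * ∫ t, φ t := by
  have hR : 0 ≤ R := hF.nonneg
  have hcv' : Continuous (fun t : ℝ => ⟪fderiv ℝ F (t • e) e, e⟫_ℝ) := by
    have h1 : Continuous (fun t : ℝ => fderiv ℝ F (t • e)) :=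
      (hF.1.continuous_fderiv one_ne_zero).comp (continuous_id.smul continuous_const)
    exact (h1.clm_apply continuous_const).inner continuous_const
  have hi : ∀ c : ℝ, Integrable (fun t => φ t * Real.sin (c * t) * ⟪fderiv ℝ F (t • e) e, e⟫_ℝ) := fun c =>
    ((φ.continuous.mul (Real.continuous_sin.comp (continuous_const.mul continuous_id))).mul hcv').integrable_of_hasCompactSupport
      (φ.hasCompactSupport.mul_right.mul_right)
  rw [← integral_sub (hi k) (hi k')]
  have hint : Integrable (fun t => |k - k'| * φ.rOut * R * φ t) := φ.integrable.const_mul _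
  rw [← integral_const_mul]
  refine le_trans (Real.norm_eq_abs _ ▸ norm_integral_le_of_norm_le hint (Eventually.of_forall fun t => ?_)) le_rfl
  have hD : |⟪fderiv ℝ F (t • e) e, e⟫_ℝ| ≤ R := by
    refine le_trans (abs_real_inner_le_norm _ _) ?_
    rw [he, mul_one]
    refine le_trans (ContinuousLinearMap.le_opNorm _ _) ?_
    rw [he, mul_one]
    have h2 := (hF.2 (t • e)).2
    have h1 : (1:ℝ) ≤ (1 + ‖t • e‖) ^ 2 := by nlinarith [norm_nonneg (t • e)]
    nlinarith [norm_nonneg (fderiv ℝ F (t • e))]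
  rw [Real.norm_eq_abs, show φ t * Real.sin (k * t) * ⟪fderiv ℝ F (t • e) e, e⟫_ℝ -
      φ t * Real.sin (k' * t) * ⟪fderiv ℝ F (t • e) e, e⟫_ℝ =
      φ t * ((Real.sin (k * t) - Real.sin (k' * t)) * ⟪fderiv ℝ F (t • e) e, e⟫_ℝ) by ring, abs_mul, abs_mul,
    abs_of_nonneg φ.nonneg]
  by_cases ht : |t| ≤ φ.rOut
  · have hs : |Real.sin (k * t) - Real.sin (k' * t)| ≤ |k - k'| * φ.rOut := by
      refine le_trans (Real.abs_sin_sub_sin_le _ _) ?_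
      rw [show k * t - k' * t = (k - k') * t by ring, abs_mul]
      exact mul_le_mul_of_nonneg_left ht (abs_nonneg _)
    calc φ t * (|Real.sin (k * t) - Real.sin (k' * t)| * |⟪fderiv ℝ F (t • e) e, e⟫_ℝ|)
        ≤ φ t * (|k - k'| * φ.rOut * R) :=
          mul_le_mul_of_nonneg_left (mul_le_mul hs hD (abs_nonneg _) (mul_nonneg (abs_nonneg _) φ.rOut_pos.le)) φ.nonneg
      _ = |k - k'| * φ.rOut * R * φ t := by ring
  · have ht' : φ.rOut < |t| := lt_of_not_ge ht
    have h0 : φ t = 0 := φ.zero_of_le_dist (by rw [Real.dist_eq, sub_zero]; exact le_of_lt ht')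
    rw [h0]; simp

end Summit.NavierStokesRegularity.NavierStokesRegularity.Theorems.KelvinGate
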